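import Summits.CriticalPhenomena.PercolationContinuityZ3.Theorems.PercNearOneGluingNoHeavyLowerTailMajorityGluingQCertSevenFive
import HarnessLib

/-!
# The `(7,5)` certificate with constant `61/50`: quadratic check on the rows `[48, 96)` (lane prim-rate, constants-miner 1, gen 34; CANDIDATES §GEN-34 R327)

Support file for the closed crux `NoHeavyLowerTail` (stmt-CriticalPhenomena-4575), majority-gluing line; continuation of `…QCertSevenFive` (two chunks of 24 variable rows,
`decide +kernel`, ≈ 32 s each).  No sorries.
-/

namespace Summit.CriticalPhenomena.PercolationContinuityZ3.Theorems

namespace HubOnly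
namespace QCert

set_option maxHeartbeats 0 in
/-- The quadratic check passes on the variable rows `[48, 72)`. -/
theorem sevenFive_checkQ_48 : sevenFive.checkQ 48 72 = true := by decide +kernel

set_option maxHeartbeats 0 in
/-- The quadratic check passes on the variable rows `[72, 96)`. -/
theorem sevenFive_checkQ_72 : sevenFive.checkQ 72 96 = true := by decide +kernel

end QCert
end HubOnly

end Summit.CriticalPhenomena.PercolationContinuityZ3.Theorems
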